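import Literature.MathematicalPhysics.QuantumManyBody.OnsagerInequality
import Literature.MathematicalPhysics.QuantumManyBody.InsertionStateIdentities
import Literature.MathematicalPhysics.QuantumManyBody.PeriodicFeynmanKacFreeForm
import Literature.MathematicalPhysics.QuantumManyBody.PeriodicBoseGasThm31
import Summits.AtomisticToContinuum.BoseEinsteinCondensation.Theses.BECRieszReverseHolder

/-!
# The pinned-particle engine of `RieszShadowFieldMoment` (route BECRieszReverseHolder)

Line `registered` of crux stmt-AtomisticToContinuum-12840; registered sub-goal
`stub_rieszFieldMomentPinned` serving the stub `stub_rieszShadowFieldMoment` (= route item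
stmt-AtomisticToContinuum-12841).

**Abstract engine.** Let `u : ℝ³ → ℝ` be continuous, even, `Lℤ³`-periodic in every axis and obey
Onsager's bound `Σ_{i<j} u(X_i - X_j) ≥ -N u(0)/2` for every `N`-point configuration (e.g. `u = b·g`,
`g` the smeared periodic Riesz kernel). Write `E(X) = Σ_{i<j} u(X_i - X_j)` and `h_X(y) = Σ_j u(y - X_j)`
(the cavity field at the pin `y`). Then for every `n`, `L > 0` and EVERY pin `y`
(`stub_rieszFieldMomentPinned`, `RieszFieldMoment.pinned_le`):

  `(1 - u(0)) ∫_{[0,L)^{3n}} e^{-E(X) - h_X(y)} dX ≤ ∫_{[0,L)^{3n}} e^{-E(X)} dX`.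

Proof. `e^{-E} = e^{-E - h_y} e^{h_y} ≥ e^{-E - h_y}(1 + h_y)` pointwise; the two pinned integrals
`D(y) = ∫ e^{-E-h_y}` and `N(y) = ∫ h_y e^{-E-h_y}` do not depend on the pin (shift `X ↦ X - y` on the
torus: `setIntegral_cellN_comp_add_of_periodic`); integrating the pin over the cell (Tonelli,
`setIntegral_cellN_succ_left_of_continuous`, and `E_{n+1}(y, X) = E_n(X) + h_X(y)`) gives
`L³ D = Z_{n+1}` and `L³ N = ∫ (Σ_{j≠0} u(Y_0 - Y_j)) e^{-E_{n+1}(Y)} dY`; by relabelling symmetry the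
latter is `(n+1)⁻¹ ∫ Σ_i Σ_{j≠i} u(Y_i - Y_j) e^{-E_{n+1}} = (n+1)⁻¹ ∫ 2E_{n+1} e^{-E_{n+1}} ≥
-u(0) Z_{n+1}` (Onsager). Hence `Z_n ≥ D + N ≥ (1 - u(0)) D`.
-/

namespace Summit.AtomisticToContinuum.BoseEinsteinCondensation.Theorems.CoarseGrainedReverseHolder

open Summit.AtomisticToContinuum.BoseEinsteinCondensation.Theses.BECRieszReverseHolder
open MeasureTheory Real UnitAddTorus
open Literature.MathematicalPhysics.StatisticalMechanics Literature.Analysis.UnboundedOperators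
open Literature.Analysis.FunctionSpaces
open Literature.MathematicalPhysics.QuantumManyBody BoseGas

namespace RieszFieldMoment

variable {n : ℕ} {L : ℝ}

/-! ### Combinatorics of the pair sum -/

/-- Splitting off the tagged particle: `Σ_{i<j≤n} u(Y_i - Y_j) = Σ_j u(y - X_j) + Σ_{i<j<n} u(X_i - X_j)`
for `Y = (y, X)`. -/
theorem pairSum_vecCons (u : Space → ℝ) (y : Space) (X : Config n) :
    (∑ i : Fin (n + 1), ∑ j : Fin (n + 1) with i < j,
        u ((Matrix.vecCons y X : Config (n + 1)) i - (Matrix.vecCons y X : Config (n + 1)) j)) =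
      (∑ j : Fin n, u (y - X j)) + ∑ i : Fin n, ∑ j : Fin n with i < j, u (X i - X j) := by
  simp only [Finset.sum_filter, Fin.sum_univ_succ, Matrix.cons_val_zero, Matrix.cons_val_succ,
    Fin.succ_lt_succ_iff, Fin.succ_pos, if_true, if_false, Fin.not_lt_zero, zero_add]

/-- The row sum of the tagged particle: `Σ_{j≤n} u(Y_0 - Y_j) = u 0 + Σ_j u(y - X_j)` for `Y = (y, X)`. -/
theorem rowSum_zero_vecCons (u : Space → ℝ) (y : Space) (X : Config n) :
    (∑ j : Fin (n + 1), u ((Matrix.vecCons y X : Config (n + 1)) 0 -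
        (Matrix.vecCons y X : Config (n + 1)) j)) = u 0 + ∑ j : Fin n, u (y - X j) := by
  simp only [Fin.sum_univ_succ, Matrix.cons_val_zero, Matrix.cons_val_succ, sub_self]

/-- `Σ_i (Σ_j u(Y_i - Y_j) - u 0) = 2 Σ_{i<j} u(Y_i - Y_j)` for an even `u`. -/
theorem sum_rowSum_sub_eq {N : ℕ} (u : Space → ℝ) (heven : ∀ z, u (-z) = u z) (Y : Config N) :
    (∑ i : Fin N, ((∑ j : Fin N, u (Y i - Y j)) - u 0)) =
      2 * ∑ i : Fin N, ∑ j : Fin N with i < j, u (Y i - Y j) := by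
  have h := Coulomb.sum_sum_eq_diag_add_two_mul (fun i j => u (Y i - Y j))
    (fun i j => by rw [← heven, neg_sub])
  simp only [sub_self] at h
  rw [Finset.sum_sub_distrib, h, Finset.sum_const, Finset.card_univ, Fintype.card_fin,
    nsmul_eq_mul]
  ring

/-- The pair sum is invariant under relabelling (even `u`). -/
theorem pairSum_comp_perm {N : ℕ} (u : Space → ℝ) (heven : ∀ z, u (-z) = u z)
    (σ : Equiv.Perm (Fin N)) (Y : Config N) :
    (∑ i : Fin N, ∑ j : Fin N with i < j, u ((Y ∘ σ) i - (Y ∘ σ) j)) =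
      ∑ i : Fin N, ∑ j : Fin N with i < j, u (Y i - Y j) := by
  have h1 := sum_rowSum_sub_eq u heven (Y ∘ σ)
  have h2 := sum_rowSum_sub_eq u heven Y
  have h3 : (∑ i : Fin N, ((∑ j : Fin N, u ((Y ∘ σ) i - (Y ∘ σ) j)) - u 0)) =
      ∑ i : Fin N, ((∑ j : Fin N, u (Y i - Y j)) - u 0) := by
    simp only [Function.comp_apply]
    rw [Equiv.sum_comp σ (fun i => (∑ j : Fin N, u (Y i - Y (σ j))) - u 0)]
    refine Finset.sum_congr rfl fun i _ => ?_
    rw [Equiv.sum_comp σ (fun j => u (Y i - Y j))]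
  linarith

/-- The row sum of particle `i` is the row sum of particle `0` after swapping `0` and `i`. -/
theorem rowSum_comp_swap {N : ℕ} (u : Space → ℝ) (i : Fin (N + 1)) (Y : Config (N + 1)) :
    (∑ j : Fin (N + 1), u ((Y ∘ Equiv.swap 0 i) 0 - (Y ∘ Equiv.swap 0 i) j)) =
      ∑ j : Fin (N + 1), u (Y i - Y j) := by
  simp only [Function.comp_apply, Equiv.swap_apply_left]
  exact Equiv.sum_comp (Equiv.swap 0 i) (fun j => u (Y i - Y j))

/-! ### Relabelling invariance of cell Bochner integrals -/

/-- `∫_{[0,L)^{3M}} G(X ∘ σ) dX = ∫_{[0,L)^{3M}} G` for the Bochner integral. -/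
theorem setIntegral_cellN_comp_perm {M : ℕ} (σ : Equiv.Perm (Fin M)) (G : Config M → ℝ) :
    ∫ X in cellN M L, G (X ∘ σ) = ∫ X in cellN M L, G X := by
  -- adapted from `BoseGas.lintegral_cellN_comp_perm`
  set e := (MeasurableEquiv.piCongrLeft (fun _ : Fin M => Space) σ).symm with he
  have hmp : MeasurePreserving e volume volume :=
    (volume_measurePreserving_piCongrLeft (fun _ : Fin M => Space) σ).symm
  have heX : ∀ (X : Config M) (j : Fin M), e X j = X (σ j) := fun X j => rfl
  have hpre : e ⁻¹' cellN M L = cellN M L := by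
    ext X
    simp only [Set.mem_preimage, cellN, Set.mem_setOf_eq, heX]
    exact ⟨fun h i => by simpa using h (σ.symm i), fun h i => h _⟩
  have key := hmp.setIntegral_preimage_emb e.measurableEmbedding G (cellN M L)
  rw [hpre] at key
  exact key

/-! ### The symmetry inequality: the mean field at a particle is at least `-u(0)` -/

/-- **Onsager + relabelling symmetry.** For an even continuous `u` obeying Onsager's bound
`Σ_{i<j} u(X_i - X_j) ≥ -N u(0)/2`, the Gibbs-weighted integral of the field felt by particle `0`,
`Σ_{j≠0} u(Y_0 - Y_j) = Σ_j u(Y_0 - Y_j) - u(0)`, is at least `-u(0)` times the partition function. -/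
theorem integral_rowSum_mul_exp_ge {N : ℕ} (u : Space → ℝ) (hu : Continuous u)
    (heven : ∀ z, u (-z) = u z)
    (hons : ∀ X : Config (N + 1), -(((N + 1 : ℕ) : ℝ) * u 0 / 2) ≤
      ∑ i : Fin (N + 1), ∑ j : Fin (N + 1) with i < j, u (X i - X j)) :
    -u 0 * ∫ Y in cellN (N + 1) L, Real.exp (-(∑ i : Fin (N + 1), ∑ j : Fin (N + 1) with i < j,
        u (Y i - Y j))) ≤
      ∫ Y in cellN (N + 1) L, ((∑ j : Fin (N + 1), u (Y 0 - Y j)) - u 0) *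
        Real.exp (-(∑ i : Fin (N + 1), ∑ j : Fin (N + 1) with i < j, u (Y i - Y j))) := by
  set E : Config (N + 1) → ℝ := fun Y => ∑ i : Fin (N + 1), ∑ j : Fin (N + 1) with i < j,
    u (Y i - Y j) with hE
  set r : Fin (N + 1) → Config (N + 1) → ℝ := fun i Y => (∑ j : Fin (N + 1), u (Y i - Y j)) - u 0
    with hr
  have hEc : Continuous E := by
    refine continuous_finsetSum _ fun i _ => continuous_finsetSum _ fun j _ => ?_
    exact hu.comp ((continuous_apply i).sub (continuous_apply j))
  have hrc : ∀ i, Continuous (r i) := fun i => by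
    refine (continuous_finsetSum _ fun j _ => ?_).sub continuous_const
    exact hu.comp ((continuous_apply i).sub (continuous_apply j))
  have hwc : Continuous fun Y => Real.exp (-E Y) := Real.continuous_exp.comp hEc.neg
  -- each particle's weighted row sum equals that of particle `0`
  have hri : ∀ i : Fin (N + 1), ∫ Y in cellN (N + 1) L, r i Y * Real.exp (-E Y) =
      ∫ Y in cellN (N + 1) L, r 0 Y * Real.exp (-E Y) := by
    intro i
    rw [← setIntegral_cellN_comp_perm (Equiv.swap 0 i) (fun Y => r 0 Y * Real.exp (-E Y))]
    refine setIntegral_congr_fun (measurableSet_cellN _ L) fun Y _ => ?_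
    simp only [hr, hE]
    rw [rowSum_comp_swap u i Y, pairSum_comp_perm u heven]
  -- sum over particles
  have hsum : ((N + 1 : ℕ) : ℝ) * ∫ Y in cellN (N + 1) L, r 0 Y * Real.exp (-E Y) =
      ∫ Y in cellN (N + 1) L, (2 * E Y) * Real.exp (-E Y) := by
    calc ((N + 1 : ℕ) : ℝ) * ∫ Y in cellN (N + 1) L, r 0 Y * Real.exp (-E Y)
        = ∑ i : Fin (N + 1), ∫ Y in cellN (N + 1) L, r i Y * Real.exp (-E Y) := by
          rw [Finset.sum_congr rfl fun i _ => hri i, Finset.sum_const, Finset.card_univ,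
            Fintype.card_fin, nsmul_eq_mul]
      _ = ∫ Y in cellN (N + 1) L, ∑ i : Fin (N + 1), r i Y * Real.exp (-E Y) := by
          rw [integral_finsetSum _ fun i _ => ?_]
          exact integrableOn_cellN ((hrc i).mul hwc) L
      _ = ∫ Y in cellN (N + 1) L, (2 * E Y) * Real.exp (-E Y) := by
          refine setIntegral_congr_fun (measurableSet_cellN _ L) fun Y _ => ?_
          rw [← Finset.sum_mul, ← sum_rowSum_sub_eq u heven Y]
  -- Onsager under the integral
  have hmono : ∫ Y in cellN (N + 1) L, (-(((N + 1 : ℕ) : ℝ) * u 0)) * Real.exp (-E Y) ≤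
      ∫ Y in cellN (N + 1) L, (2 * E Y) * Real.exp (-E Y) := by
    refine setIntegral_mono_on (integrableOn_cellN (continuous_const.mul hwc) L)
      (integrableOn_cellN ((continuous_const.mul hEc).mul hwc) L) (measurableSet_cellN _ L)
      fun Y _ => ?_
    refine mul_le_mul_of_nonneg_right ?_ (Real.exp_pos _).le
    have := hons Y
    simp only [hE]
    linarith
  rw [integral_const_mul] at hmono
  have hpos : (0 : ℝ) < ((N + 1 : ℕ) : ℝ) := by positivity
  rw [← hsum] at hmono
  have : -(u 0) * ∫ Y in cellN (N + 1) L, Real.exp (-E Y) ≤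
      ∫ Y in cellN (N + 1) L, r 0 Y * Real.exp (-E Y) := by
    by_contra hcon
    have := mul_lt_mul_of_pos_left (not_le.mp hcon) hpos
    linarith
  simpa only [hr, hE, neg_mul] using this


/-! ### Periodicity and translation of the pinned-particle integrands -/

/-- A periodic even function is periodic under subtraction of a period as well. -/
theorem sub_single_of_periodic_even (u : Space → ℝ) (heven : ∀ z, u (-z) = u z)
    (hper : ∀ (z : Space) (k : Fin 3), u (z + EuclideanSpace.single k L) = u z)
    (z : Space) (k : Fin 3) : u (z - EuclideanSpace.single k L) = u z := by
  rw [← heven, neg_sub, sub_eq_neg_add, hper, heven]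

/-- Pair differences are unchanged, up to a period, by moving one particle by a period. -/
theorem pair_periodic (u : Space → ℝ) (heven : ∀ z, u (-z) = u z)
    (hper : ∀ (z : Space) (k : Fin 3), u (z + EuclideanSpace.single k L) = u z)
    (X : Config n) (i : Fin n) (k : Fin 3) (a c : Fin n) :
    u ((X + Pi.single i (EuclideanSpace.single k L) : Config n) a -
        (X + Pi.single i (EuclideanSpace.single k L) : Config n) c) = u (X a - X c) := by
  simp only [Pi.add_apply, Pi.single_apply]
  by_cases ha : a = i <;> by_cases hc : c = i <;> simp only [ha, hc, if_true, if_false, add_zero]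
  · rw [add_sub_add_right_eq_sub]
  · rw [show X i + EuclideanSpace.single k L - X c = (X i - X c) + EuclideanSpace.single k L by abel,
      hper]
  · rw [show X a - (X i + EuclideanSpace.single k L) = (X a - X i) - EuclideanSpace.single k L by abel,
      sub_single_of_periodic_even u heven hper]

/-- The pinned-at-the-origin weight `w(X) Φ(Σ_j u(0 - X_j)) · exp(-Σ_{i<j} u(X_i - X_j) - Σ_j u(0 - X_j))`
is periodic in every particle and axis (for any outer function `Φ`). -/
theorem pinned_periodic (u : Space → ℝ) (heven : ∀ z, u (-z) = u z)
    (hper : ∀ (z : Space) (k : Fin 3), u (z + EuclideanSpace.single k L) = u z) (Φ : ℝ → ℝ)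
    (X : Config n) (i : Fin n) (k : Fin 3) :
    (fun X : Config n => Φ (∑ j : Fin n, u (0 - X j)) *
        Real.exp (-(∑ a : Fin n, ∑ c : Fin n with a < c, u (X a - X c)) - ∑ j : Fin n, u (0 - X j)))
        (X + Pi.single i (EuclideanSpace.single k L)) =
      (fun X : Config n => Φ (∑ j : Fin n, u (0 - X j)) *
        Real.exp (-(∑ a : Fin n, ∑ c : Fin n with a < c, u (X a - X c)) - ∑ j : Fin n, u (0 - X j))) X := by
  have h1 : ∀ j : Fin n, u (0 - (X + Pi.single i (EuclideanSpace.single k L) : Config n) j) =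
      u (0 - X j) := by
    intro j
    simp only [Pi.add_apply, Pi.single_apply]
    by_cases hj : j = i
    · simp only [hj, if_true]
      rw [show (0 : Space) - (X i + EuclideanSpace.single k L) = (0 - X i) - EuclideanSpace.single k L
        by abel, sub_single_of_periodic_even u heven hper]
    · simp only [hj, if_false, add_zero]
  simp only [h1, pair_periodic u heven hper X i k]

/-- Shifting the pin: the integrands at pin `y` are the integrands at pin `0` translated by `-y`. -/
theorem pinned_shift (u : Space → ℝ) (Φ : ℝ → ℝ) (y : Space) (X : Config n) :
    Φ (∑ j : Fin n, u (y - X j)) *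
        Real.exp (-(∑ a : Fin n, ∑ c : Fin n with a < c, u (X a - X c)) - ∑ j : Fin n, u (y - X j)) =
      (fun X : Config n => Φ (∑ j : Fin n, u (0 - X j)) *
        Real.exp (-(∑ a : Fin n, ∑ c : Fin n with a < c, u (X a - X c)) - ∑ j : Fin n, u (0 - X j)))
        (X + -fun _ => y) := by
  simp only [Pi.add_apply, Pi.neg_apply, zero_sub, neg_add_rev, neg_neg, add_sub_add_right_eq_sub]
  rfl

/-- Continuity of the pinned integrands. -/
theorem continuous_pinned (u : Space → ℝ) (hu : Continuous u) {Φ : ℝ → ℝ} (hΦ : Continuous Φ)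
    (y : Space) :
    Continuous fun X : Config n => Φ (∑ j : Fin n, u (y - X j)) *
      Real.exp (-(∑ a : Fin n, ∑ c : Fin n with a < c, u (X a - X c)) - ∑ j : Fin n, u (y - X j)) := by
  have h1 : Continuous fun X : Config n => ∑ j : Fin n, u (y - X j) :=
    continuous_finsetSum _ fun j _ => hu.comp (continuous_const.sub (continuous_apply j))
  have h2 : Continuous fun X : Config n => ∑ a : Fin n, ∑ c : Fin n with a < c, u (X a - X c) :=
    continuous_finsetSum _ fun a _ => continuous_finsetSum _ fun c _ =>
      hu.comp ((continuous_apply a).sub (continuous_apply c))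
  exact (hΦ.comp h1).mul (Real.continuous_exp.comp (h2.neg.sub h1))

/-- **Translation invariance of the pinned integrals**: the pin may be moved to the origin. -/
theorem setIntegral_pinned_eq (hL : 0 < L) (u : Space → ℝ) (hu : Continuous u)
    (heven : ∀ z, u (-z) = u z)
    (hper : ∀ (z : Space) (k : Fin 3), u (z + EuclideanSpace.single k L) = u z) {Φ : ℝ → ℝ}
    (hΦ : Continuous Φ) (y : Space) :
    ∫ X in cellN n L, Φ (∑ j : Fin n, u (y - X j)) *
        Real.exp (-(∑ a : Fin n, ∑ c : Fin n with a < c, u (X a - X c)) - ∑ j : Fin n, u (y - X j)) =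
      ∫ X in cellN n L, Φ (∑ j : Fin n, u (0 - X j)) *
        Real.exp (-(∑ a : Fin n, ∑ c : Fin n with a < c, u (X a - X c)) - ∑ j : Fin n, u (0 - X j)) := by
  simp_rw [pinned_shift u Φ y]
  exact setIntegral_cellN_comp_add_of_periodic hL
    ((continuous_pinned u hu hΦ 0).aestronglyMeasurable)
    (fun X i k => pinned_periodic u heven hper Φ X i k) _

/-! ### Tonelli: integrating the pin over the cell -/

/-- `∫_{[0,L)³} (∫_{[0,L)^{3n}} pinned integrand at y) dy = ∫_{[0,L)^{3(n+1)}} Φ(row sum of 0 - u 0)·e^{-E}`. -/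
theorem integral_cell_setIntegral_pinned (u : Space → ℝ) (hu : Continuous u) {Φ : ℝ → ℝ}
    (hΦ : Continuous Φ) :
    ∫ y in cell L, ∫ X in cellN n L, Φ (∑ j : Fin n, u (y - X j)) *
        Real.exp (-(∑ a : Fin n, ∑ c : Fin n with a < c, u (X a - X c)) - ∑ j : Fin n, u (y - X j)) =
      ∫ Y in cellN (n + 1) L, Φ ((∑ j : Fin (n + 1), u (Y 0 - Y j)) - u 0) *
        Real.exp (-(∑ a : Fin (n + 1), ∑ c : Fin (n + 1) with a < c, u (Y a - Y c))) := by
  have hc : Continuous fun Y : Config (n + 1) => Φ ((∑ j : Fin (n + 1), u (Y 0 - Y j)) - u 0) *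
      Real.exp (-(∑ a : Fin (n + 1), ∑ c : Fin (n + 1) with a < c, u (Y a - Y c))) := by
    refine (hΦ.comp ((continuous_finsetSum _ fun j _ =>
      hu.comp ((continuous_apply 0).sub (continuous_apply j))).sub continuous_const)).mul
      (Real.continuous_exp.comp (continuous_finsetSum _ fun a _ => continuous_finsetSum _ fun c _ =>
        hu.comp ((continuous_apply a).sub (continuous_apply c))).neg)
  rw [setIntegral_cellN_succ_left_of_continuous hc]
  refine setIntegral_congr_fun (measurableSet_cell L) fun y _ => ?_
  refine setIntegral_congr_fun (measurableSet_cellN n L) fun X _ => ?_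
  rw [rowSum_zero_vecCons u y X, pairSum_vecCons u y X, add_sub_cancel_left, add_comm, neg_add']

/-! ### The `θ = 1` bound -/

/-- **The `θ = 1` field moment.** For a continuous even periodic `u` with Onsager's bound and
`u(0) < 1`: for every pin `y`,
`(1 - u 0) ∫_{[0,L)^{3n}} e^{-Σ_{i<j} u(X_i-X_j) - Σ_j u(y - X_j)} dX ≤ ∫_{[0,L)^{3n}} e^{-Σ_{i<j} u(X_i-X_j)} dX`. -/
theorem pinned_le (hL : 0 < L) (u : Space → ℝ) (hu : Continuous u) (heven : ∀ z, u (-z) = u z)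
    (hper : ∀ (z : Space) (k : Fin 3), u (z + EuclideanSpace.single k L) = u z)
    (hons : ∀ (N : ℕ) (X : Config N), -((N : ℝ) * u 0 / 2) ≤
      ∑ i : Fin N, ∑ j : Fin N with i < j, u (X i - X j)) (y : Space) :
    (1 - u 0) * ∫ X in cellN n L,
        Real.exp (-(∑ a : Fin n, ∑ c : Fin n with a < c, u (X a - X c)) - ∑ j : Fin n, u (y - X j)) ≤
      ∫ X in cellN n L, Real.exp (-(∑ a : Fin n, ∑ c : Fin n with a < c, u (X a - X c))) := by
  -- notation
  set D : Space → ℝ := fun y => ∫ X in cellN n L,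
    Real.exp (-(∑ a : Fin n, ∑ c : Fin n with a < c, u (X a - X c)) - ∑ j : Fin n, u (y - X j)) with hD
  set Nn : Space → ℝ := fun y => ∫ X in cellN n L, (∑ j : Fin n, u (y - X j)) *
    Real.exp (-(∑ a : Fin n, ∑ c : Fin n with a < c, u (X a - X c)) - ∑ j : Fin n, u (y - X j)) with hNn
  set Z : ℝ := ∫ X in cellN n L, Real.exp (-(∑ a : Fin n, ∑ c : Fin n with a < c, u (X a - X c))) with hZ
  set Z' : ℝ := ∫ Y in cellN (n + 1) L,
    Real.exp (-(∑ a : Fin (n + 1), ∑ c : Fin (n + 1) with a < c, u (Y a - Y c))) with hZ'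
  set N' : ℝ := ∫ Y in cellN (n + 1) L, ((∑ j : Fin (n + 1), u (Y 0 - Y j)) - u 0) *
    Real.exp (-(∑ a : Fin (n + 1), ∑ c : Fin (n + 1) with a < c, u (Y a - Y c))) with hN'
  have hEc : Continuous fun X : Config n => ∑ a : Fin n, ∑ c : Fin n with a < c, u (X a - X c) :=
    continuous_finsetSum _ fun a _ => continuous_finsetSum _ fun c _ =>
      hu.comp ((continuous_apply a).sub (continuous_apply c))
  have hhc : ∀ y : Space, Continuous fun X : Config n => ∑ j : Fin n, u (y - X j) := fun y =>
    continuous_finsetSum _ fun j _ => hu.comp (continuous_const.sub (continuous_apply j))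
  -- translation invariance: D y = D 0, Nn y = Nn 0
  have hD0 : ∀ y, D y = D 0 := by
    intro y
    have h := setIntegral_pinned_eq (n := n) hL u hu heven hper (Φ := fun _ => (1 : ℝ))
      continuous_const y
    simpa only [one_mul] using h
  have hN0 : ∀ y, Nn y = Nn 0 := fun y =>
    setIntegral_pinned_eq (n := n) hL u hu heven hper (Φ := fun t => t) continuous_id y
  -- Tonelli: ∫_cell D = Z', ∫_cell Nn = N'
  have hDint : ∫ y in cell L, D y = Z' := by
    have h := integral_cell_setIntegral_pinned (n := n) (L := L) u hu (Φ := fun _ => (1 : ℝ))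
      continuous_const
    simpa only [one_mul] using h
  have hNint : ∫ y in cell L, Nn y = N' :=
    integral_cell_setIntegral_pinned (n := n) (L := L) u hu (Φ := fun t => t) continuous_id
  have hvol : (volume.restrict (cell L)).real Set.univ = L ^ 3 := by
    rw [measureReal_restrict_apply_univ, Measure.real, volume_cell, ← ENNReal.ofReal_pow hL.le,
      ENNReal.toReal_ofReal (by positivity)]
  have hDc : ∫ y in cell L, D y = L ^ 3 * D 0 := by
    rw [funext hD0]
    simp only [integral_const, smul_eq_mul, hvol]
  have hNc : ∫ y in cell L, Nn y = L ^ 3 * Nn 0 := by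
    rw [funext hN0]
    simp only [integral_const, smul_eq_mul, hvol]
  -- symmetry: N' ≥ -u 0 * Z'
  have hsym : -u 0 * Z' ≤ N' :=
    integral_rowSum_mul_exp_ge (L := L) u hu heven (fun X => hons (n + 1) X)
  -- pointwise: e^{-E} ≥ e^{-E-h} (1 + h)
  have hpt : ∀ X : Config n,
      Real.exp (-(∑ a : Fin n, ∑ c : Fin n with a < c, u (X a - X c)) - ∑ j : Fin n, u (y - X j)) +
        (∑ j : Fin n, u (y - X j)) *
          Real.exp (-(∑ a : Fin n, ∑ c : Fin n with a < c, u (X a - X c)) - ∑ j : Fin n, u (y - X j)) ≤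
      Real.exp (-(∑ a : Fin n, ∑ c : Fin n with a < c, u (X a - X c))) := by
    intro X
    set E := ∑ a : Fin n, ∑ c : Fin n with a < c, u (X a - X c)
    set h := ∑ j : Fin n, u (y - X j)
    have h1 : Real.exp (-E - h) + h * Real.exp (-E - h) = (h + 1) * Real.exp (-E - h) := by ring
    rw [h1, show Real.exp (-E) = Real.exp h * Real.exp (-E - h) by
      rw [← Real.exp_add]; ring_nf]
    exact mul_le_mul_of_nonneg_right (Real.add_one_le_exp h) (Real.exp_pos _).le
  have hexp : Continuous fun X : Config n =>
      Real.exp (-(∑ a : Fin n, ∑ c : Fin n with a < c, u (X a - X c)) - ∑ j : Fin n, u (y - X j)) :=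
    Real.continuous_exp.comp (hEc.neg.sub (hhc y))
  have hi1 : IntegrableOn (fun X : Config n =>
      Real.exp (-(∑ a : Fin n, ∑ c : Fin n with a < c, u (X a - X c)) - ∑ j : Fin n, u (y - X j)))
      (cellN n L) volume := integrableOn_cellN hexp L
  have hi2 : IntegrableOn (fun X : Config n => (∑ j : Fin n, u (y - X j)) *
      Real.exp (-(∑ a : Fin n, ∑ c : Fin n with a < c, u (X a - X c)) - ∑ j : Fin n, u (y - X j)))
      (cellN n L) volume := integrableOn_cellN ((hhc y).mul hexp) L
  have hZge : D y + Nn y ≤ Z := by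
    simp only [hD, hNn, hZ]
    rw [← integral_add hi1 hi2]
    exact setIntegral_mono_on (hi1.add hi2) (integrableOn_cellN (Real.continuous_exp.comp hEc.neg) L)
      (measurableSet_cellN n L) fun X _ => hpt X
  -- assemble
  have hL3 : (0 : ℝ) < L ^ 3 := by positivity
  have e1 : L ^ 3 * D 0 = Z' := by rw [← hDc, hDint]
  have e2 : L ^ 3 * Nn 0 = N' := by rw [← hNc, hNint]
  have key : L ^ 3 * ((1 - u 0) * D 0) ≤ L ^ 3 * (D 0 + Nn 0) := by
    have e3 : L ^ 3 * ((1 - u 0) * D 0) = Z' + -u 0 * Z' := by rw [← e1]; ring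
    rw [e3, mul_add, e1, e2]
    linarith [hsym]
  have key' : (1 - u 0) * D 0 ≤ D 0 + Nn 0 := le_of_mul_le_mul_left key hL3
  calc (1 - u 0) * D y = (1 - u 0) * D 0 := by rw [hD0 y]
    _ ≤ D 0 + Nn 0 := key'
    _ = D y + Nn y := by rw [hD0 y, hN0 y]
    _ ≤ Z := hZge

end RieszFieldMoment

/-- **The pinned-particle (`θ = 1`) field moment, abstract form** (registered sub-goal): for a
continuous, even, periodic `u` with Onsager's bound, `(1 - u 0) ∫ e^{-E - h_y} ≤ ∫ e^{-E}` on the cell,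
for every `n`, `L > 0` and pin `y`. -/
theorem stub_rieszFieldMomentPinned : ∀ (n : ℕ) (L : ℝ), 0 < L → ∀ u : BoseGas.Space → ℝ, Continuous u → (∀ z : BoseGas.Space, u (-z) = u z) → (∀ (z : BoseGas.Space) (k : Fin 3), u (z + EuclideanSpace.single k L) = u z) → (∀ (N : ℕ) (X : BoseGas.Config N), -((N : ℝ) * u 0 / 2) ≤ ∑ i : Fin N, ∑ j : Fin N with i < j, u (X i - X j)) → ∀ y : BoseGas.Space, (1 - u 0) * ∫ X in BoseGas.cellN n L, Real.exp (-(∑ i : Fin n, ∑ j : Fin n with i < j, u (X i - X j)) - ∑ j : Fin n, u (y - X j)) ≤ ∫ X in BoseGas.cellN n L, Real.exp (-(∑ i : Fin n, ∑ j : Fin n with i < j, u (X i - X j))) :=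
  fun _n _L hL u hu heven hper hons y => RieszFieldMoment.pinned_le hL u hu heven hper hons y

end Summit.AtomisticToContinuum.BoseEinsteinCondensation.Theorems.CoarseGrainedReverseHolder
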